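import Summits.Ventures.HSemireg.WedgeHankelRecurrenceHankelDeterminant
import Literature.RingTheory.Norm.NormResultant

/-!
# Venture HSemireg — THE HANKEL DETERMINANT OF A RATIONAL CLASS IS THE RESULTANT (Kronecker 1881 ∕ Hermite 1856, the printed form of N73): for `m` monic of degree `d = t + 1` and any `a`,
# **`det M_a = N_{K[X]/(m) ∕ K}(a mod m) = Res(m, a)`**, hence **`det (dualSeq m a (i + j))_{i,j ≤ t} = sign(reversal) · Res(m, a)`** and `Res(m, a) ≠ 0 ⟺ gcd(m, a) = 1`
# («the Hankel determinant of order `d` of the Taylor coefficients of `a/m` is `± Res(m, a)`»)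

HONEST FRAMING. Part of the Lean index of the computation cell `pub-hsemireg` (seat p10 gen 31, Sunday typer «UNIFORM-IN-n»).
LINEAR ALGEBRA OF HANKEL (catalecticant) MATRICES and of polynomials over a field ONLY (`Polynomial.resultant`, `Algebra.norm`, `AdjoinRoot`): no variety, no cohomology theory, no sheaf, no Ext
group and no semiregularity map is constructed here; nothing here says that HC / HC_CM / HC_AV holds.  No unproved named fact is used: the PROVED Literature module `Literature.RingTheory.Norm.NormResultant`
(Cohen, *A Course in Computational Algebraic Number Theory*, Prop. 4.3.4 in general form: `norm_adjoinRoot_mk_eq_resultant : Algebra.norm K (AdjoinRoot.mk T A) = resultant T A` for monic `T`) is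
imported and this file is the DICTIONARY between it and N73's Hankel ∕ multiplication-matrix determinants — nothing of it is restated.  Custodian versions as in `WedgeHankelSiegelIdeal` (1/3).

WHAT IS IN THE TREE.  N73 (`WedgeHankelRecurrenceHankelDeterminant`): `mulResidueMat t m a` (`(M_a)_{kj} = [X^k](X^j a mod m)`), `det_hankelSq_dualSeq` (`det H_t(a/m) = sign(revPerm) · det M_a`),
`det_mulResidueMat_eq_norm` (`det M_a = Algebra.norm K (AdjoinRoot.mk m a)`), `det_mulResidueMat_ne_zero_iff` (`⟺ IsCoprime m a`).  Literature (`NormResultant`): as above.  Mathlib: `Polynomial.resultant f g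
(m := f.natDegree) (n := g.natDegree)` (determinant of the Sylvester matrix), `resultant_add_right_deg`, `resultant_X_sub_C_right`, `Polynomial.map_modByMonic`.
THIS FILE (namespace `Summit.Ventures.HSemireg.Wedge.HankelOuter` continued; PLAIN on N73 + that Literature module; 0 definitions):
* §651 **`det_mulResidueMat_eq_resultant`** (`det M_a = Res(m, a)` at Mathlib's default degrees `(deg m, deg a)`, `m` monic of degree `t + 1`, any `a`, any field), `det_mulResidueMat_eq_resultant_of_le`
  (any right degree `n ≥ deg a`: `lc(m) = 1`), **`det_hankelSq_dualSeq_eq_sign_mul_resultant`** (KRONECKER–HERMITE in print: `det H_t(a/m) = sign(revPerm) · Res(m, a)`),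
  `resultant_ne_zero_iff_isCoprime_of_monic` (`Res(m, a) ≠ 0 ⟺ gcd(m, a) = 1` for monic `m` of positive degree, read off N73 — Mathlib's `resultant_eq_zero_iff` is the general field statement),
  `det_mulResidueMat_X_sub_C` (`det M_{X − β} = (−1)^{t+1} m(β)`), `mulResidueMat_map` (`M_a` commutes with extension of scalars `φ : K →+* L`).
Nothing Ext-side.  New names only.
-/

open Module Polynomial
open scoped Matrix Polynomial

namespace Summit.Ventures.HSemireg.Wedge.HankelOuter

open Summit.Ventures.HSemireg.Wedge Summit.Ventures.HSemireg.Wedge.Hankel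

variable (K : Type*) [Field K]

/-! ## §651. `det M_a = Res(m, a)` -/

/-- **`det M_a = Res(m, a)`** for `m` monic of degree `t + 1` and any `a` (Mathlib's `Polynomial.resultant` at the default degrees `(deg m, deg a)`): `det M_a` is the norm of `a mod m` (N73), and
the norm from `K[X]/(m)` is the resultant (Literature `NormResultant`, Cohen Prop. 4.3.4). Any field. -/
theorem det_mulResidueMat_eq_resultant {t : ℕ} {m : K[X]} (hm : m.Monic) (hmd : m.natDegree = t + 1) (a : K[X]) : (mulResidueMat K t m a).det = Polynomial.resultant m a := by
  rw [det_mulResidueMat_eq_norm K hm hmd, Literature.RingTheory.Norm.norm_adjoinRoot_mk_eq_resultant hm]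

/-- `det M_a = Res(m, a)` computed at the degrees `(t + 1, n)` for any `n ≥ deg a` (`m` monic of degree `t + 1`: raising the right degree multiplies by `lc(m)^k = 1`). -/
theorem det_mulResidueMat_eq_resultant_of_le {t : ℕ} {m : K[X]} (hm : m.Monic) (hmd : m.natDegree = t + 1) {a : K[X]} {n : ℕ} (hn : a.natDegree ≤ n) :
    (mulResidueMat K t m a).det = Polynomial.resultant m a (t + 1) n := by
  obtain ⟨k, rfl⟩ := Nat.exists_eq_add_of_le hn
  have hc : m.coeff (t + 1) = 1 := by rw [← hmd]; exact hm.coeff_natDegree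
  rw [Polynomial.resultant_add_right_deg _ _ _ _ _ le_rfl, hc, one_pow, one_mul, det_mulResidueMat_eq_resultant K hm hmd, hmd]

/-- **KRONECKER–HERMITE IN PRINT: `det (dualSeq m a (i + j))_{i,j ≤ t} = sign(reversal) · Res(m, a)`** for `m` monic of degree `t + 1` and any `a` (the Hankel determinant of order `t + 1` of the
coefficients of `a/m`). Any field. -/
theorem det_hankelSq_dualSeq_eq_sign_mul_resultant {t : ℕ} {m : K[X]} (hm : m.Monic) (hmd : m.natDegree = t + 1) (a : K[X]) :
    (hankelSq K t (dualSeq K m a)).det = Equiv.Perm.sign (Fin.revPerm : Equiv.Perm (Fin (t + 1))) * Polynomial.resultant m a := by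
  rw [det_hankelSq_dualSeq K hm hmd, det_mulResidueMat_eq_resultant K hm hmd]

/-- `Res(m, a) ≠ 0 ⟺ gcd(m, a) = 1` for `m` monic of positive degree (read off N73's `det M_a ≠ 0 ⟺ IsCoprime m a`; Mathlib's `resultant_eq_zero_iff` is the general statement over a field). -/
theorem resultant_ne_zero_iff_isCoprime_of_monic [DecidableEq K] {m : K[X]} (hm : m.Monic) (hd : 0 < m.natDegree) (a : K[X]) : Polynomial.resultant m a ≠ 0 ↔ IsCoprime m a := by
  obtain ⟨t, ht⟩ : ∃ t, m.natDegree = t + 1 := ⟨m.natDegree - 1, (Nat.sub_add_cancel hd).symm⟩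
  rw [← det_mulResidueMat_eq_resultant K hm ht, det_mulResidueMat_ne_zero_iff K hm ht]

/-- `det M_{X − β} = (−1)^{t+1} · m(β)` (`m` monic of degree `t + 1`; `Res(m, X − β) = (−1)^{deg m} m(β)`). -/
theorem det_mulResidueMat_X_sub_C {t : ℕ} {m : K[X]} (hm : m.Monic) (hmd : m.natDegree = t + 1) (β : K) :
    (mulResidueMat K t m (Polynomial.X - C β)).det = (-1) ^ (t + 1) * m.eval β := by
  rw [det_mulResidueMat_eq_resultant K hm hmd, Polynomial.natDegree_X_sub_C, hmd, Polynomial.resultant_X_sub_C_right _ _ _ (hmd ▸ le_rfl)]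

/-- the multiplication matrix commutes with extension of scalars: `(M_a)^φ = M_{a^φ}` computed modulo `m^φ` (`m` monic; `φ : K →+* L` a field map). -/
theorem mulResidueMat_map {L : Type*} [Field L] (φ : K →+* L) (t : ℕ) {m : K[X]} (hm : m.Monic) (a : K[X]) :
    (mulResidueMat K t m a).map φ = mulResidueMat L t (m.map φ) (a.map φ) := by
  ext k j
  simp only [Matrix.map_apply, mulResidueMat_apply, ← Polynomial.coeff_map, Polynomial.map_modByMonic φ hm, Polynomial.map_mul, Polynomial.map_pow, Polynomial.map_X]

end Summit.Ventures.HSemireg.Wedge.HankelOuter
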